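import Literature.AlgebraicGeometry.Pohlmann1968.HodgeClassesCMType
import Literature.AlgebraicGeometry.ComplexMultiplication.PrincipalModelOfCMOrder
import HarnessLib

/-!
# Pohlmann's theorem, PRODUCT form (CM algebra `E = K^n`): the Hodge classes of `⨁_{i<n} A_{(K; Φ_i)}` are
# spanned by the Galois-balanced weight monomials — typed on the real carriers (cited fact)

Companion of `Pohlmann1968/HodgeClassesCMType` (Pohlmann 1968, Thm. 1, for ONE CM type, the tree's
`Pohlmann1968.Pohlmann1968_thm1`).  The face/lattice reduction of the Hodge conjecture for CM abelian
varieties (the consumers of `HodgeTheory/WeilClassesCMReductionProductForm`, André's product form, and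
of the rank-four faces) reads Pohlmann's theorem on a PRODUCT `B = ⨁_{i<n} A_i` of realisations
`(A_i, ι_i, θ_i)` of CM types `Φ_i` of ONE CM field `K`, i.e. for the CM ALGEBRA `E = K^n ⊂ End⁰(B)` with
`H¹(B, ℚ)` free of rank one over `E` — the generality in which the theorem is PRINTED WITH PROOF in

* Z. Gao, E. Ullmo, J. Inst. Math. Jussieu 25 (2025) 215–249 [GaoUllmo2025], §2.1 + **Theorem 3.1
  "(Pohlmann)"** (held `paper:galaxy-pdf-4667137180`, chunk p0007 L1–L7 and p0012 L3–L16), VERBATIM: "A CM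
  algebra is a finite product of CM fields. … A CM pair is a pair `(E, Φ)` consisting of a CM algebra `E`
  and a CM type `Φ`." — "Let `A` be a CM abelian variety, associated with the CM pair `(E, Φ)`. … `G` acts on
  `Hom(E, ℂ) = Φ ⊔ Φ̄` … **Theorem 3.1** (Pohlmann). For each `p ≥ 0`, the vector space `B^p(A) ⊗ ℂ` has a
  basis consisting of `[P]` for those ordered sets `P ∈ 𝒫(S)` with `|P| = 2p` such that
  (3.2) `|σP ∩ Φ| = |σP ∩ Φ̄|` for all `σ ∈ G`. In particular `dim_ℚ B^p(A)` is the number of ordered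
  `P ∈ 𝒫(S)` with `|P| = 2p` satisfying (3.2). **Proof.** Pohlmann [Poh68, Thm. 1] states this result when
  `A` is simple. The proof remains valid for an arbitrary CM abelian variety `A`." (proof: ibid. L10–L16);
* J. S. Milne, *Hodge classes on abelian varieties* (2020) [Milne2020HodgeClassesAV], 1.1–1.2 (held
  `paper:arxiv-2010.08857`, chunk p0003), VERBATIM: "A complex abelian variety is said to be of CM-type if
  `End⁰(A)` contains a CM-algebra `E` such that `H¹(A,ℚ)` is free of rank `1` as an `E`-module. Let
  `S = Hom(E,ℂ)` … `H^{1,0}(A) = ⊕_{s∈Φ} H¹(A)_s`" and 1.2 "(a) `H^r(A) ≃ ⋀^r_F H¹(A) = ⊕_Δ H^r(A)_Δ` … where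
  `Δ` runs over the subsets of `S` of size `|Δ| = r` and `H^r(A)_Δ = ⊗_{s∈Δ} H¹(A)_s` is the
  (one-dimensional) subspace on which `a ∈ E` acts as `∏_{s∈Δ} s(a)`. … (c) ([pohlmann1968], Theorem 1.)
  Let `B^p = H^{2p}(A,ℚ) ∩ H^{p,p}` … Then `B^p ⊗ F = ⊕_Δ H^{2p}(A)_Δ`, where `Δ` runs over the subsets of
  `S` with `|(t∘Δ) ∩ Φ| = p = |(t∘Δ) ∩ Φ̄|` for all `t ∈ Gal(F/ℚ)`";
* H. Pohlmann, Ann. of Math. (2) 88 (1968) 161–180 [Pohlmann1968], Thm. 1 — the case `n = 1` (one CM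
  field), primary not held (acq-07563), quoted through Gordon 1999 §9.2 in the companion file.

## Rendering on the tree's carriers

For `E = K^n`: `Hom(E, ℂ) = Fin n × Hom(K, ℂ)` (an algebra map `K^n → ℂ` factors through one projection),
the CM type of `B = ⨁ A_i` is `Φ = ⊔_i {i} × Φ_i`, and `a = (a_i)_i ∈ 𝓞_K^n ⊂ E` acts on `B` by the
endomorphism `⊕_i ι_i(a_i)` (`biproduct.map`), so that

* `weightClasses A ι k S ⊆ H^k(B(ℂ); ℂ)`, for `S ⊆ Fin n × Hom(K, ℂ)` finite — Milne's `H^k(A)_Δ`, `Δ = S`: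
  the simultaneous eigenspace of the pull-backs `(⊕_i ι_i(a_i))^*`, `a ∈ 𝓞_K^n`, with character
  `a ↦ ∏_{(i,s) ∈ S} s(a_i)` ("the subspace on which `a ∈ E` acts as `∏_{s∈Δ} s(a)`"; the weight vectors /
  Hodge monomials `e_S` of the stage-1 package's `Universe.IsWeightVector`, tree-side and product-free in
  the action: no factor-wise projections are needed since `𝓞_K^n` already separates the slots);
* `IsGaloisBalancedFamily Φ S` — Gao–Ullmo's (3.2) for the pair `(K^n, ⊔_i {i} × Φ_i)`:
  `#{(i,s) ∈ S | τ∘s ∈ Φ_i} = #{(i,s) ∈ S | τ∘s ∉ Φ_i}` for every `τ ∈ Aut(ℂ)` (index-set convention and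
  `Set.ncard` form exactly as `Pohlmann1968.IsGaloisBalanced`, whose `n = 1` analogue it is);
* `pohlmannSetsFamily Φ p = {S | |S| = 2p, balanced}`;
* **`Pohlmann1968_thm1_product`** (NAMED FACT): for every CM field `K`, every finite family of
  realisations `(A_i, ι_i, θ_i)` of CM types `Φ_i` of `K` (the tree's
  `ComplexMultiplication.IsCMTypeRealisation`, as in `Andre1992_hodgeClasses_cmTypedProduct_mem_span_pullback_weilLines`)
  and every `p`: (i) `B^p(B) ⊗ ℂ = hodgeClassSpan (⨁ A).dim (⨁ A).X p` EQUALS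
  `⨆_{S ∈ pohlmannSetsFamily Φ p} weightClasses A ι (2p) S`; (ii) its `ℂ`-dimension is the number of such
  `S`.  Hodge-type index `(⨁ A).dim`, the convention of the André product-form record.

## Faithfulness / scope

* WEAKER than Gao–Ullmo's printed Theorem 3.1 (there: any CM algebra `E = ∏ K_j` and any `A` associated
  with `(E, Φ)`; here: `E = K^n` for ONE CM field `K`, `B` a product of realisations with `𝓞_K` acting
  integrally on every factor — the shape of the face/lattice consumers and of the stage-1 package's
  `PohlmannSpan`, product form over one Galois CM field).  -- TODO(general form): distinct fields `K_j`
  and a general order of `E` in place of `𝓞_K^n`.  `K` Galois is NOT assumed (the condition is stated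
  with `Aut(ℂ)`, which acts on `Hom(K, ℂ)` through the Galois group of the Galois closure).
* `n = 1`: `⨁_{Fin 1} A ≅ A 0` and the statement becomes `Pohlmann1968.Pohlmann1968_thm1` for
  `(A 0, ι 0, θ 0)` after transport along that isomorphism and `Fin 1 × Hom(K,ℂ) ≃ Hom(K,ℂ)` (not carried
  out here; the two records are kept separate and both cite Thm. 1 / Thm. 3.1).
* Related tree objects: the model theorem `GaoUllmo2025.theorem31` (kernel proof of Thm. 3.1 in the
  combinatorial model `⋀^{2p} ℂ^S`, any CM algebra); `HodgeTheory.weilLineClasses` of the André product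
  file (the `K`-Weil line = `⨆_s` of the weight classes of the "column" weights `Fin m × {s}` for the
  diagonal action); the stage-1 package `run/shared/lean/pub/pub-hodgecm/lean/HodgeCMPerL/HodgeCM/Geometry/
  WeightVectors.lean` (`IsWeightVector`, `PohlmannSpan` — the `⊆` half of (i), kernel there modulo the
  model facts M29/M30).
* DISCHARGED in this file (`Pohlmann1968_thm1_product_holds`, section "Discharge" below): the fact is now
  a theorem of the tree; consumers keep taking `(h : Pohlmann1968_thm1_product)` and are fed
  `Pohlmann1968_thm1_product_holds`.

## References

* [GaoUllmo2025] Z. Gao, E. Ullmo, J. Inst. Math. Jussieu 25 (2025) 215–249 — §2.1, Thm. 3.1 with proof.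
* [Milne2020HodgeClassesAV] J. S. Milne, arXiv:2010.08857 — 1.1, 1.2 (a)–(c).
* [Pohlmann1968] H. Pohlmann, Ann. of Math. (2) 88 (1968) 161–180 — Thm. 1 (`n = 1`; not held, acq-07563).
* [Gordon1999HodgeAVSurvey] B. B. Gordon, CRM Monogr. 10 (1999) — §9.2 (the `n = 1` restatement with proof).

## Provenance

Cell `pub-hodgecm2` (COR-CM), literature seat `pub-hodgecm2-lit-pohlmann`; binder table
`run/shared/lean/pub/pub-hodgecm2/lit/pohlmann.md` row P1′.  Three definitions with unfolding lemmas, ONE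
named fact, consequences proved from it; no axiom, no sorry.

## Discharge (seat `pub-hodgecm2-lit-pohlmann-g2`)

`theorem Pohlmann1968_thm1_product_holds : Pohlmann1968_thm1_product`, sorry-free, axioms
`propext, Classical.choice, Quot.sound`.  It FOLLOWS THE PRINTED PROOF (Gao–Ullmo, proof of Thm. 3.1,
p0012 L10–L16; Gordon §9.2; Milne 1.2) on the index set `Hom(K^n, ℂ) = Fin n × Hom(K, ℂ)`, re-using the
engine of the one-type discharge `Pohlmann1968_thm1_holds` (`Pohlmann1968/HodgeClassesCMType`:
`exists_monomialBasis`, `map_monomial_eq_prod_smul`, `isOfHodgeType_monomial`,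
`mem_span_monomials_of_isRationalClass`, `monomial_mem_span_of_stable`, `exists_eigenbasis`, the Galois
closure lemmas).  New ingredients, proved here:

* `H¹(⨁ A_j) = ⊕_j π_j^* H¹(A_j)` — Künneth in degree one for a finite biproduct, from `𝟙 = Σ π_j ≫ ι_j`
  (`biproduct.total`) and the additivity of pull-backs on `H¹` (`HodgeTheory.complexBetti_map_add_one`):
  `sum_map_π_map_ι`, `exists_biproductBasis` (the basis `π_j^* v_{j,s}`), `map_biproductMap_map_π`
  (`(⊕ g_j)^* π_j^* = π_j^* g_j^*`);
* `isGaloisBalancedFamily_iff_gal` — condition (3.2) over `Aut(ℂ)` = over `G = Gal(K^c/ℚ)`;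
* a separating family `a ∈ 𝓞_K^n` (all weight characters `∏_{(i,σ)∈S} σ(a_i)` pairwise distinct), private.
-/

noncomputable section

open CategoryTheory CategoryTheory.Limits NumberField

namespace Literature.AlgebraicGeometry.Pohlmann1968

open Literature.AlgebraicGeometry.Motives (AbelianVariety CMType)
open Literature.AlgebraicGeometry.HodgeTheory (complexBetti)
open Literature.AlgebraicGeometry.ComplexMultiplication (IsCMTypeRealisation)
open Literature.AlgebraicGeometry.VanGeemen1994 (hodgeClassSpan)

section Defs

variable {K : Type} [Field K] {n : ℕ}
variable (A : Fin n → AbelianVariety ℂ) (ι : ∀ i, 𝓞 K →+* End (A i))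

/-- **`H^k(B)_S ⊆ H^k(B(ℂ); ℂ)`, the weight classes of weight `S`** on the product `B = ⨁_{i<n} A_i` of abelian
varieties with `𝓞_K`-actions `ι_i`, for a finite `S ⊆ Fin n × Hom(K, ℂ) = Hom(K^n, ℂ)`: the classes `c`
with `(⊕_i ι_i(a_i))^* c = (∏_{(i,s) ∈ S} s(a_i)) · c` for every `a = (a_i)_i ∈ 𝓞_K^n` — Milne 1.2 (a) for
the CM algebra `E = K^n`: "`H^r(A)_Δ = ⊗_{s∈Δ} H¹(A)_s` is the (one-dimensional) subspace on which `a ∈ E`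
acts as `∏_{s∈Δ} s(a)`"; Gao–Ullmo's `ℂ·[P]`.  A `ℂ`-submodule for all data (meaningful data: the
families of realisations `IsCMTypeRealisation (Φ i) (A i) (ι i) (θ i)`; `0` for `|S| ≠ k` on such data).
[cite: Milne2020HodgeClassesAV, 1.1–1.2 (a)] [cite: GaoUllmo2025, §2.1 and Thm. 3.1] -/
def weightClasses (k : ℕ) (S : Finset (Fin n × (K →+* ℂ))) : Submodule ℂ (complexBetti (⨁ A).X k) where
  carrier := {c | ∀ a : Fin n → 𝓞 K,
    complexBetti.map (biproduct.map fun i => ι i (a i)).hom.hom.hom k c =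
      (∏ x ∈ S, x.2 ((a x.1 : 𝓞 K) : K)) • c}
  add_mem' {c c'} hc hc' a := by rw [map_add, hc a, hc' a, smul_add]
  zero_mem' a := by rw [map_zero, smul_zero]
  smul_mem' z {c} hc a := by rw [map_smul, hc a, smul_comm]

variable {A ι} in
/-- Membership in `weightClasses` is the defining eigen-condition (definitional unfolding).
[cite: Milne2020HodgeClassesAV, 1.2 (a)] -/
theorem mem_weightClasses_iff {k : ℕ} {S : Finset (Fin n × (K →+* ℂ))} {c : complexBetti (⨁ A).X k} :
    c ∈ weightClasses A ι k S ↔ ∀ a : Fin n → 𝓞 K,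
      complexBetti.map (biproduct.map fun i => ι i (a i)).hom.hom.hom k c =
        (∏ x ∈ S, x.2 ((a x.1 : 𝓞 K) : K)) • c :=
  Iff.rfl

/-- **Gao–Ullmo's condition (3.2) for the CM pair `(K^n, ⊔_i {i} × Φ_i)`** (= Milne 1.2 (1); Pohlmann's
condition for `n = 1`): "`|σP ∩ Φ| = |σP ∩ Φ̄|` for all `σ ∈ G`", i.e. for every `τ`,
`#{(i,s) ∈ S | τ ∘ s ∈ Φ_i} = #{(i,s) ∈ S | τ ∘ s ∉ Φ_i}`; `τ` ranges over `Aut(ℂ)` (same condition as with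
the Galois group of the Galois closure, see `Pohlmann1968/HodgeClassesCMType`).
[cite: GaoUllmo2025, Thm. 3.1 (3.2)] [cite: Milne2020HodgeClassesAV, 1.2 (c)] -/
def IsGaloisBalancedFamily (Φ : Fin n → CMType K) (S : Finset (Fin n × (K →+* ℂ))) : Prop :=
  ∀ τ : ℂ ≃+* ℂ,
    {x | x ∈ S ∧ (τ : ℂ →+* ℂ).comp x.2 ∈ (Φ x.1).1}.ncard =
      {x | x ∈ S ∧ (τ : ℂ →+* ℂ).comp x.2 ∉ (Φ x.1).1}.ncard

/-- **The index set of Theorem 3.1 for `(K^n, ⊔Φ_i)`**: the `S ⊆ Fin n × Hom(K, ℂ)` with `|S| = 2p` satisfying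
(3.2) ("ordered `P ∈ 𝒫(S)` with `|P| = 2p` satisfying (3.2)"). [cite: GaoUllmo2025, Thm. 3.1] -/
def pohlmannSetsFamily (Φ : Fin n → CMType K) (p : ℕ) : Set (Finset (Fin n × (K →+* ℂ))) :=
  {S | S.card = 2 * p ∧ IsGaloisBalancedFamily Φ S}

/-- Unfolding of `IsGaloisBalancedFamily`. [cite: GaoUllmo2025, Thm. 3.1 (3.2)] -/
theorem isGaloisBalancedFamily_iff {Φ : Fin n → CMType K} {S : Finset (Fin n × (K →+* ℂ))} :
    IsGaloisBalancedFamily Φ S ↔ ∀ τ : ℂ ≃+* ℂ,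
      {x | x ∈ S ∧ (τ : ℂ →+* ℂ).comp x.2 ∈ (Φ x.1).1}.ncard =
        {x | x ∈ S ∧ (τ : ℂ →+* ℂ).comp x.2 ∉ (Φ x.1).1}.ncard :=
  Iff.rfl

/-- Unfolding of `pohlmannSetsFamily`. [cite: GaoUllmo2025, Thm. 3.1] -/
theorem mem_pohlmannSetsFamily_iff {Φ : Fin n → CMType K} {p : ℕ} {S : Finset (Fin n × (K →+* ℂ))} :
    S ∈ pohlmannSetsFamily Φ p ↔ S.card = 2 * p ∧ IsGaloisBalancedFamily Φ S :=
  Iff.rfl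

/-- A balanced weight has `|S| = 2 · #{(i,s) ∈ S | s ∈ Φ_i}` (take `τ = 1`; for `|S| = 2p` this is
`|S ∩ Φ| = p = |S ∩ Φ̄|`, Milne's form of the condition at `t = 1`). [cite: Milne2020HodgeClassesAV, 1.2 (c)] -/
theorem IsGaloisBalancedFamily.card_eq_two_mul {Φ : Fin n → CMType K} {S : Finset (Fin n × (K →+* ℂ))}
    (h : IsGaloisBalancedFamily Φ S) :
    S.card = 2 * {x | x ∈ S ∧ x.2 ∈ (Φ x.1).1}.ncard := by
  have h1 := h (RingEquiv.refl ℂ)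
  have hcomp : ∀ s : K →+* ℂ, ((RingEquiv.refl ℂ : ℂ ≃+* ℂ) : ℂ →+* ℂ).comp s = s := fun s =>
    RingHom.ext fun _ => rfl
  simp only [hcomp] at h1
  have hdisj : Disjoint {x | x ∈ S ∧ x.2 ∈ (Φ x.1).1} {x | x ∈ S ∧ x.2 ∉ (Φ x.1).1} :=
    Set.disjoint_left.mpr fun x hx hx' => hx'.2 hx.2
  have hunion : {x | x ∈ S ∧ x.2 ∈ (Φ x.1).1} ∪ {x | x ∈ S ∧ x.2 ∉ (Φ x.1).1} =
      (S : Set (Fin n × (K →+* ℂ))) := by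
    ext x
    simp only [Set.mem_union, Set.mem_setOf_eq, Finset.mem_coe]
    tauto
  have hfin₁ : {x | x ∈ S ∧ x.2 ∈ (Φ x.1).1}.Finite := S.finite_toSet.subset fun x hx => hx.1
  have hfin₂ : {x | x ∈ S ∧ x.2 ∉ (Φ x.1).1}.Finite := S.finite_toSet.subset fun x hx => hx.1
  have hsum := Set.ncard_union_eq hdisj hfin₁ hfin₂
  rw [hunion, Set.ncard_coe_finset] at hsum
  omega

/-- The empty weight is balanced (`p = 0`: `B⁰ ⊗ ℂ = H⁰`). [cite: GaoUllmo2025, Thm. 3.1] -/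
theorem isGaloisBalancedFamily_empty (Φ : Fin n → CMType K) : IsGaloisBalancedFamily Φ ∅ := fun _ => by
  simp only [Finset.notMem_empty, false_and, Set.setOf_false, Set.ncard_empty]

/-- `∅ ∈ pohlmannSetsFamily Φ 0`. [cite: GaoUllmo2025, Thm. 3.1] -/
theorem empty_mem_pohlmannSetsFamily_zero (Φ : Fin n → CMType K) :
    (∅ : Finset (Fin n × (K →+* ℂ))) ∈ pohlmannSetsFamily Φ 0 :=
  ⟨by simp, isGaloisBalancedFamily_empty Φ⟩

/-- The "column" weight `univ × {s}` of the André product file's `K`-Weil line: for the DIAGONAL action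
(`a_i = a` for all `i`; `HodgeTheory.diagonalAction A ι a = biproduct.map fun i => ι i a`, by
`HodgeTheory.diagonalAction_def`) its character is `a ↦ s(a)^n`, so the weight classes of
`Finset.univ ×ˢ {s}` lie in the `s(a)^n`-eigenspaces of the diagonal pull-backs — the dictionary between this
file's weights and `HodgeTheory.weilLineClasses` (`= ⨆_s ⨅_a` of these eigenspaces).
[cite: Milne2020HodgeClassesAV, Theorem 1 (proof: "`a ∈ E` acts on `H^{2p}(A_Δ)_{Δ×{t}}` as multiplication by `∏_{s∈Δ}(t∘s)(a)`")] -/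
theorem weightClasses_univ_product_singleton_le_iInf_eigenspace (k : ℕ) (s : K →+* ℂ) :
    weightClasses A ι k (Finset.univ ×ˢ {s}) ≤
      ⨅ a : 𝓞 K, Module.End.eigenspace
        (complexBetti.map (biproduct.map fun i => ι i a).hom.hom.hom k).hom ((s a) ^ n) := by
  intro c hc
  rw [Submodule.mem_iInf]
  intro a
  rw [Module.End.mem_eigenspace_iff]
  have h : complexBetti.map (biproduct.map fun i => ι i a).hom.hom.hom k c =
      (∏ x ∈ (Finset.univ : Finset (Fin n)) ×ˢ ({s} : Finset (K →+* ℂ)), x.2 ((a : 𝓞 K) : K)) • c :=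
    hc (fun _ => a)
  have hprod : (∏ x ∈ (Finset.univ : Finset (Fin n)) ×ˢ ({s} : Finset (K →+* ℂ)),
      x.2 ((a : 𝓞 K) : K)) = (s a) ^ n := by
    rw [Finset.prod_product]
    simp
  rw [hprod] at h
  exact h

end Defs

/-! ### The named fact -/

/-- **Pohlmann's theorem, product form `E = K^n`** (Gao–Ullmo 2025, Thm. 3.1 "(Pohlmann)", for the CM pair
`(K^n, ⊔_i {i} × Φ_i)`; Milne 2020, 1.2 (c); Pohlmann 1968, Thm. 1 for `n = 1`), VERBATIM (Gao–Ullmo): "For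
each `p ≥ 0`, the vector space `B^p(A) ⊗ ℂ` has a basis consisting of `[P]` for those ordered sets
`P ∈ 𝒫(S)` with `|P| = 2p` such that `|σP ∩ Φ| = |σP ∩ Φ̄|` for all `σ ∈ G`. In particular `dim_ℚ B^p(A)` is
the number of ordered `P ∈ 𝒫(S)` with `|P| = 2p` satisfying (3.2)."  TYPED on the carriers: for every CM
field `K`, every finite family `(A_i, ι_i, θ_i)_{i<n}` of realisations of CM types `Φ_i` of `K` read on `H¹`
(`IsCMTypeRealisation (Φ i) (A i) (ι i) (θ i)`), `B = ⨁ A` their product, and every `p`: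
(i) `B^p(B) ⊗ ℂ = hodgeClassSpan (⨁ A).dim (⨁ A).X p` EQUALS the supremum of the weight-class spaces
`weightClasses A ι (2p) S` over `S ∈ pohlmannSetsFamily Φ p` (`|S| = 2p`, balanced); (ii) its
`ℂ`-dimension is the number of such `S`.  WEAKER than the printed theorem (one CM field, maximal orders);
users take `(h : Pohlmann1968_thm1_product)`.
[cite: GaoUllmo2025, Thm. 3.1] [cite: Milne2020HodgeClassesAV, 1.2 (c)] [cite: Pohlmann1968, Thm. 1] -/
def Pohlmann1968_thm1_product : Prop :=
  ∀ (K : Type) [Field K] [NumberField K] [IsCMField K] (n : ℕ) (A : Fin n → AbelianVariety ℂ)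
    (Φ : Fin n → CMType K) (ι : ∀ i, 𝓞 K →+* End (A i))
    (θ : ∀ i, K →+* Module.End ℂ (complexBetti (A i).X 1)),
    (∀ i, IsCMTypeRealisation (Φ i) (A i) (ι i) (θ i)) → ∀ p : ℕ,
      hodgeClassSpan (⨁ A).dim (⨁ A).X p =
          ⨆ S ∈ pohlmannSetsFamily Φ p, weightClasses A ι (2 * p) S ∧
        Module.finrank ℂ ↥(hodgeClassSpan (⨁ A).dim (⨁ A).X p) = (pohlmannSetsFamily Φ p).ncard

/-! ### Consequences recorded for consumers (proved from the fact) -/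

section Consequences

variable {K : Type} [Field K] [NumberField K] [IsCMField K] {n : ℕ} {A : Fin n → AbelianVariety ℂ}
  {Φ : Fin n → CMType K} {ι : ∀ i, 𝓞 K →+* End (A i)}
  {θ : ∀ i, K →+* Module.End ℂ (complexBetti (A i).X 1)}

/-- Under the fact, the weight classes of a balanced weight of size `2p` are in `B^p(B) ⊗ ℂ` (the `⊇` half:
"`[P] ∈ B^p(A) ⊗ ℂ`"). [cite: GaoUllmo2025, Thm. 3.1] -/
theorem Pohlmann1968_thm1_product.weightClasses_le_hodgeClassSpan (h : Pohlmann1968_thm1_product)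
    (hA : ∀ i, IsCMTypeRealisation (Φ i) (A i) (ι i) (θ i)) {p : ℕ} {S : Finset (Fin n × (K →+* ℂ))}
    (hS : S ∈ pohlmannSetsFamily Φ p) :
    weightClasses A ι (2 * p) S ≤ hodgeClassSpan (⨁ A).dim (⨁ A).X p := by
  rw [(h K n A Φ ι θ hA p).1]
  exact le_iSup₂_of_le S hS le_rfl

/-- Under the fact, every rational `(p,p)`-class of the product lies in the span of the weight classes of
the balanced weights (the `⊆` half: "each element of `B^p(A)` … So each `P_j` satisfies (3.2)"; the
stage-1 package's `PohlmannSpan`). [cite: GaoUllmo2025, Thm. 3.1] -/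
theorem Pohlmann1968_thm1_product.mem_iSup_weightClasses (h : Pohlmann1968_thm1_product)
    (hA : ∀ i, IsCMTypeRealisation (Φ i) (A i) (ι i) (θ i)) {p : ℕ} {c : complexBetti (⨁ A).X (2 * p)}
    (hcQ : HodgeTheory.IsRationalClass c)
    (hcH : HodgeTheory.IsOfHodgeType (⨁ A).dim (⨁ A).X (2 * p) p p c) :
    c ∈ ⨆ S ∈ pohlmannSetsFamily Φ p, weightClasses A ι (2 * p) S := by
  rw [← (h K n A Φ ι θ hA p).1]
  exact Submodule.subset_span ⟨hcQ, hcH⟩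

end Consequences

/-! ## Discharge of the named fact (seat `pub-hodgecm2-lit-pohlmann-g2`)

The printed proof of Gao–Ullmo Thm. 3.1 / Milne 1.2 (c) for `E = K^n`, run on the carriers with the
engine of `Pohlmann1968/HodgeClassesCMType`. -/

open Module
open Literature.AlgebraicTopology.SingularHomology
open Literature.AlgebraicGeometry.Motives (IsSmoothProjective ComplexPoints)
open Literature.AlgebraicGeometry.HodgeTheory

/-! ### Product discharge, step 0: linear algebra (private copies of the one-type file's helpers) -/

section LinearAlgebraP

/-- In a basis of eigenvectors of `φ` with pairwise distinct eigenvalues `λ i`, a vector on which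
`φ` acts by `λ i₀` lies on the line `ℂ · b i₀`. [folklore] -/
private theorem mem_span_singleton_of_apply_eq_smul' {ι M : Type*} [Fintype ι] [AddCommGroup M]
    [Module ℂ M] (b : Basis ι ℂ M) (φ : M →ₗ[ℂ] M) (lam : ι → ℂ)
    (hφ : ∀ i, φ (b i) = lam i • b i) (hlam : Function.Injective lam) {x : M} {i₀ : ι}
    (hx : φ x = lam i₀ • x) : x ∈ ℂ ∙ b i₀ := by
  have hx' : ∑ i, (b.repr x i * lam i - lam i₀ * b.repr x i) • b i = 0 := by
    simp only [sub_smul, Finset.sum_sub_distrib, mul_smul]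
    rw [sub_eq_zero]
    have h1 : φ x = ∑ i, b.repr x i • lam i • b i := by
      conv_lhs => rw [← b.sum_repr x]
      simp only [map_sum, map_smul, hφ]
    have h2 : lam i₀ • x = ∑ i, lam i₀ • b.repr x i • b i := by
      conv_lhs => rw [← b.sum_repr x]
      rw [Finset.smul_sum]
    rw [← h1, ← h2, hx]
  have hcoef := Fintype.linearIndependent_iff.1 b.linearIndependent _ hx'
  have hzero : ∀ i, i ≠ i₀ → b.repr x i = 0 := by
    intro i hi
    have h := hcoef i
    rw [mul_comm (lam i₀), ← mul_sub, mul_eq_zero] at h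
    rcases h with h | h
    · exact h
    · exact absurd (hlam (sub_eq_zero.1 h)) hi
  rw [Submodule.mem_span_singleton]
  refine ⟨b.repr x i₀, ?_⟩
  conv_rhs => rw [← b.sum_repr x]
  rw [Finset.sum_eq_single i₀ (fun i _ hi => by rw [hzero i hi, zero_smul])
    (fun h => absurd (Finset.mem_univ i₀) h)]

/-- The span of the members `b t`, `t ∈ B`, of a basis has dimension `|B|`. [folklore] -/
private theorem finrank_span_image_basis' {ι M : Type*} [AddCommGroup M] [Module ℂ M]
    (b : Basis ι ℂ M) (B : Finset ι) :
    Module.finrank ℂ (Submodule.span ℂ (b '' ↑B)) = B.card := by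
  have hli : LinearIndependent ℂ (fun t : ↥B => b t) :=
    b.linearIndependent.comp _ Subtype.val_injective
  rw [show b '' ↑B = Set.range (fun t : ↥B => b t) by ext; simp, finrank_span_eq_card hli,
    Fintype.card_coe]

/-- Counting through an embedding. [folklore] -/
private theorem ncard_sep_map_eq' {α β : Type*} (f : α ↪ β) (s : Finset α) (Q : β → Prop) :
    {i | i ∈ s.map f ∧ Q i}.ncard = {j | j ∈ s ∧ Q (f j)}.ncard := by
  rw [show {i | i ∈ s.map f ∧ Q i} = f '' {j | j ∈ s ∧ Q (f j)} by
      ext i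
      simp only [Finset.mem_map, Set.mem_setOf_eq, Set.mem_image]
      constructor
      · rintro ⟨⟨j, hj, rfl⟩, hQ⟩; exact ⟨j, ⟨hj, hQ⟩, rfl⟩
      · rintro ⟨j, ⟨hj, hQ⟩, rfl⟩; exact ⟨⟨j, hj, rfl⟩, hQ⟩,
    Set.ncard_image_of_injective _ f.injective]

end LinearAlgebraP

/-! ### Product discharge, step 1: `H¹(⨁ Aⱼ) = ⊕ⱼ πⱼ^* H¹(Aⱼ)` (Künneth in degree one for a finite
biproduct of complex abelian varieties, from `𝟙 = Σ πⱼ ≫ ιⱼ` and the additivity of pull-backs on `H¹`) -/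

section BiproductH1

variable {J : Type}

/-- Pull-backs on `H¹` are additive over finite sums of homomorphisms of abelian varieties
(`(Σ fⱼ)^* = Σ fⱼ^*` on `H¹`; the tree's `complexBetti_map_add_one`, `complexBetti_map_zero_one`).
[cite: LangeBirkenhake1992, §1.1 (p. 19)] -/
theorem complexBetti_map_sum_one_apply {X Y : AbelianVariety ℂ} (s : Finset J) (f : J → (X ⟶ Y))
    (x : complexBetti Y.X 1) :
    complexBetti.map (∑ j ∈ s, f j).hom.hom.hom 1 x =
      ∑ j ∈ s, complexBetti.map (f j).hom.hom.hom 1 x := by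
  classical
  induction s using Finset.induction_on with
  | empty =>
    rw [Finset.sum_empty, Finset.sum_empty, complexBetti_map_zero_one]
    rfl
  | insert a s ha ih =>
    rw [Finset.sum_insert ha, Finset.sum_insert ha, complexBetti_map_add_one, ← ih]
    rfl

variable [Fintype J] (A : J → AbelianVariety ℂ)

/-- `ιⱼ^* πⱼ^* = id` on `H¹(Aⱼ)` (`ιⱼ ≫ πⱼ = 𝟙`). [cite: HatcherAT2002, §3.2 Thm. 3.16] -/
theorem map_ι_map_π_self (j : J) (x : complexBetti (A j).X 1) :
    complexBetti.map (biproduct.ι A j).hom.hom.hom 1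
      (complexBetti.map (biproduct.π A j).hom.hom.hom 1 x) = x := by
  change singularCohomology.map ℂ ℂ _ 1 (singularCohomology.map ℂ ℂ _ 1 x) = x
  rw [abelianVarietyHom_map_map_apply, biproduct.ι_π_self]
  exact abelianVariety_map_id_apply x

/-- `ιᵢ^* πⱼ^* = 0` on `H¹(Aⱼ)` for `i ≠ j` (`ιᵢ ≫ πⱼ = 0`, and the zero homomorphism kills `H¹`,
`complexBetti_map_zero_one`). [cite: HatcherAT2002, §3.2 Thm. 3.16] -/
theorem map_ι_map_π_ne {i j : J} (h : i ≠ j) (x : complexBetti (A j).X 1) :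
    complexBetti.map (biproduct.ι A i).hom.hom.hom 1
      (complexBetti.map (biproduct.π A j).hom.hom.hom 1 x) = 0 := by
  change singularCohomology.map ℂ ℂ _ 1 (singularCohomology.map ℂ ℂ _ 1 x) = 0
  rw [abelianVarietyHom_map_map_apply, biproduct.ι_π_ne A h]
  change complexBetti.map (0 : A i ⟶ A j).hom.hom.hom 1 x = 0
  rw [complexBetti_map_zero_one]
  rfl

/-- **`x = Σⱼ πⱼ^* ιⱼ^* x` on `H¹(⨁ Aⱼ)`** (pull back `𝟙 = Σⱼ πⱼ ≫ ιⱼ`, `biproduct.total`).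
[cite: HatcherAT2002, §3.2 Thm. 3.16] -/
theorem sum_map_π_map_ι (x : complexBetti (⨁ A).X 1) :
    ∑ j, complexBetti.map (biproduct.π A j).hom.hom.hom 1
      (complexBetti.map (biproduct.ι A j).hom.hom.hom 1 x) = x := by
  classical
  have h := complexBetti_map_sum_one_apply Finset.univ
    (fun j => biproduct.π A j ≫ biproduct.ι A j) x
  rw [biproduct.total] at h
  have h1 : complexBetti.map (𝟙 (⨁ A) : (⨁ A) ⟶ (⨁ A)).hom.hom.hom 1 x = x :=
    abelianVariety_map_id_apply x
  rw [h1] at h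
  calc ∑ j, complexBetti.map (biproduct.π A j).hom.hom.hom 1
        (complexBetti.map (biproduct.ι A j).hom.hom.hom 1 x)
      = ∑ j, complexBetti.map (biproduct.π A j ≫ biproduct.ι A j).hom.hom.hom 1 x :=
        Finset.sum_congr rfl fun j _ => abelianVarietyHom_map_map_apply _ _ _
    _ = x := h.symm

/-- **An `H¹`-basis of a finite biproduct from `H¹`-bases of the factors**: if `v j` is a basis of
`H¹(Aⱼ(ℂ); ℂ)` for each `j`, the classes `πⱼ^* (v j s)` form a basis of `H¹((⨁ Aⱼ)(ℂ); ℂ)` indexed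
by `J × S` (Künneth in degree one for a product of connected spaces).
[cite: HatcherAT2002, §3.2 Thm. 3.16] [cite: LangeBirkenhake1992, §1.1] -/
theorem exists_biproductBasis {S : Type} [Fintype S]
    (v : ∀ j, Basis S ℂ (complexBetti (A j).X 1)) :
    ∃ w : Basis (J × S) ℂ (complexBetti (⨁ A).X 1),
      ∀ x, w x = complexBetti.map (biproduct.π A x.1).hom.hom.hom 1 (v x.1 x.2) := by
  classical
  let f : J × S → complexBetti (⨁ A).X 1 := fun x =>
    complexBetti.map (biproduct.π A x.1).hom.hom.hom 1 (v x.1 x.2)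
  have hli : LinearIndependent ℂ f := by
    rw [Fintype.linearIndependent_iff]
    rintro c hc ⟨i, s⟩
    have h : complexBetti.map (biproduct.ι A i).hom.hom.hom 1 (∑ x, c x • f x) =
        complexBetti.map (biproduct.ι A i).hom.hom.hom 1 0 := by rw [hc]
    rw [map_sum, map_zero, Fintype.sum_prod_type,
      Finset.sum_eq_single i (fun j _ hji => by
        refine Finset.sum_eq_zero fun s _ => ?_
        rw [map_smul]
        change c (j, s) • complexBetti.map (biproduct.ι A i).hom.hom.hom 1
          (complexBetti.map (biproduct.π A j).hom.hom.hom 1 (v j s)) = 0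
        rw [map_ι_map_π_ne A (Ne.symm hji), smul_zero])
      (fun h => absurd (Finset.mem_univ i) h)] at h
    have h' : ∑ s, c (i, s) • v i s = 0 := by
      rw [← h]
      refine Finset.sum_congr rfl fun s _ => ?_
      rw [map_smul]
      change _ = c (i, s) • complexBetti.map (biproduct.ι A i).hom.hom.hom 1
        (complexBetti.map (biproduct.π A i).hom.hom.hom 1 (v i s))
      rw [map_ι_map_π_self]
    exact Fintype.linearIndependent_iff.1 (v i).linearIndependent (fun s => c (i, s)) h' s
  have hsp : ⊤ ≤ Submodule.span ℂ (Set.range f) := by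
    intro x _
    rw [← sum_map_π_map_ι A x]
    refine Submodule.sum_mem _ fun j _ => ?_
    rw [← (v j).sum_repr (complexBetti.map (biproduct.ι A j).hom.hom.hom 1 x), map_sum]
    refine Submodule.sum_mem _ fun s _ => ?_
    rw [map_smul]
    exact Submodule.smul_mem _ _ (Submodule.subset_span ⟨(j, s), rfl⟩)
  exact ⟨Basis.mk hli hsp, fun x => by rw [Basis.mk_apply]⟩

/-- A componentwise endomorphism `⊕ⱼ gⱼ` of the biproduct acts on `πⱼ^* y` through `gⱼ`:
`(⊕ g)^* πⱼ^* y = πⱼ^* gⱼ^* y` (`biproduct.map g ≫ πⱼ = πⱼ ≫ gⱼ`).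
[cite: LangeBirkenhake1992, §1.1] -/
theorem map_biproductMap_map_π (g : ∀ j, A j ⟶ A j) (j : J) (k : ℕ)
    (y : complexBetti (A j).X k) :
    complexBetti.map (biproduct.map g).hom.hom.hom k
        (complexBetti.map (biproduct.π A j).hom.hom.hom k y) =
      complexBetti.map (biproduct.π A j).hom.hom.hom k
        (complexBetti.map (g j).hom.hom.hom k y) := by
  change singularCohomology.map ℂ ℂ _ k (singularCohomology.map ℂ ℂ _ k y) =
    singularCohomology.map ℂ ℂ _ k (singularCohomology.map ℂ ℂ _ k y)
  rw [abelianVarietyHom_map_map_apply, abelianVarietyHom_map_map_apply, biproduct.map_π]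

end BiproductH1

/-! ### Product discharge, step 2: Pohlmann's condition for families over `Aut(ℂ)` = over
`G = Gal(K^c/ℚ)`; a separating family of integral elements -/

section GaloisP

open Literature.AlgebraicGeometry.GaoUllmo2025 (galoisClosure corestrict galAct)

variable {K : Type} [Field K] [NumberField K] {n : ℕ}

/-- **Condition (3.2) over `Aut(ℂ)` is condition (3.2) over `G = Gal(K^c/ℚ)`** for the CM pair
`(K^n, ⊔_i {i} × Φ_i)`: both groups act on `Hom(K^n, ℂ) = Fin n × Hom(K, ℂ)` with the same
permutations (`exists_ringEquiv_extends_gal`, `exists_gal_restricts_ringEquiv`).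
[cite: GaoUllmo2025, Thm. 3.1 (3.2) and proof] [cite: Gordon1999HodgeAVSurvey, §9.2 (9.2.1)] -/
theorem isGaloisBalancedFamily_iff_gal (Φ : Fin n → CMType K) (S : Finset (Fin n × (K →+* ℂ))) :
    IsGaloisBalancedFamily Φ S ↔ ∀ τ : galoisClosure K ≃ₐ[ℚ] galoisClosure K,
      {x | x ∈ S ∧ (galAct K τ x.2.toRatAlgHom).toRingHom ∈ (Φ x.1).1}.ncard =
        {x | x ∈ S ∧ (galAct K τ x.2.toRatAlgHom).toRingHom ∉ (Φ x.1).1}.ncard := by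
  constructor
  · intro h τ
    obtain ⟨τ', hτ'⟩ := exists_ringEquiv_extends_gal τ
    simp only [← hτ']
    exact h τ'
  · intro h τ'
    obtain ⟨τ, hτ⟩ := exists_gal_restricts_ringEquiv (K := K) τ'
    have := h τ
    simp only [hτ] at this
    exact this

open Polynomial in
/-- **A separating family of integral elements**: some `a = (a_i)_i ∈ 𝓞_K^n` has pairwise distinct
weight characters `∏_{(i,σ) ∈ S} σ(a_i)` over ALL finite `S ⊆ Fin n × Hom(K, ℂ)` (take
`a_i = a₀ + iM + N` with `a₀` an integral primitive element, `M ∈ ℕ` making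
`(i, σ) ↦ σ(a₀) + iM` injective, and `N ∈ ℕ` avoiding the finitely many roots of the differences
`∏_{x ∈ S} (X + σ a₀ + iM) - ∏_{x ∈ T} (X + σ a₀ + iM)`, `S ≠ T`). [folklore] -/
private theorem exists_separating_family (K : Type) [Field K] [NumberField K] (n : ℕ) :
    ∃ a : Fin n → 𝓞 K, Function.Injective
      fun S : Finset (Fin n × (K →+* ℂ)) => ∏ x ∈ S, x.2 ((a x.1 : 𝓞 K) : K) := by
  classical
  -- an integral element `a` separating the embeddings
  obtain ⟨α, hα⟩ := Field.exists_primitive_element ℚ K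
  have hinjα : Function.Injective fun φ : K →ₐ[ℚ] ℂ => φ α :=
    (Field.primitive_element_iff_algHom_eq_of_eval' ℚ ℂ (fun x => IsAlgClosed.splits _) α).1 hα
  have hαℤ : IsAlgebraic ℤ α :=
    (IsFractionRing.isAlgebraic_iff ℤ ℚ K).2 (Algebra.IsAlgebraic.isAlgebraic α)
  obtain ⟨m, a, hm, hma⟩ := hαℤ.exists_nsmul_eq (𝓞 K)
  have hinja : Function.Injective fun σ : K →+* ℂ => σ (a : K) := by
    intro σ σ' h
    have h' : σ α = σ' α := by
      have hσ : σ (a : K) = (m : ℂ) * σ α := by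
        rw [show ((a : 𝓞 K) : K) = m • α from hma.symm, nsmul_eq_mul, map_mul, map_natCast]
      have hσ' : σ' (a : K) = (m : ℂ) * σ' α := by
        rw [show ((a : 𝓞 K) : K) = m • α from hma.symm, nsmul_eq_mul, map_mul, map_natCast]
      have hh : (m : ℂ) * σ α = (m : ℂ) * σ' α := by rw [← hσ, ← hσ']; exact h
      exact mul_left_cancel₀ (Nat.cast_ne_zero.2 hm) hh
    have h'' := hinjα (show (fun φ : K →ₐ[ℚ] ℂ => φ α) σ.toRatAlgHom =
      (fun φ : K →ₐ[ℚ] ℂ => φ α) σ'.toRatAlgHom from h')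
    rw [← RingHom.toRatAlgHom_toRingHom σ, ← RingHom.toRatAlgHom_toRingHom σ', h'']
  -- slot shifts `i·M` making `(i, σ) ↦ σ(a) + i·M` injective
  set bad₁ : Finset ℂ :=
    (Finset.univ : Finset ((Fin n × (K →+* ℂ)) × (Fin n × (K →+* ℂ)))).image
      fun xy => (xy.1.2 (a : K) - xy.2.2 (a : K)) / (((xy.2.1 : ℕ) : ℂ) - ((xy.1.1 : ℕ) : ℂ))
    with hbad₁_def
  obtain ⟨M, hM⟩ : ∃ M : ℕ, (M : ℂ) ∉ bad₁ := by
    by_contra h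
    simp only [not_exists, not_not] at h
    exact Set.Infinite.mono (Set.range_subset_iff.2 fun N => (Finset.mem_coe.2 (h N)))
      (Set.infinite_range_of_injective (Nat.cast_injective (R := ℂ))) bad₁.finite_toSet
  set w : Fin n × (K →+* ℂ) → ℂ := fun x => -(x.2 (a : K) + ((x.1 : ℕ) : ℂ) * M) with hw_def
  have hw : Function.Injective w := by
    rintro ⟨i, σ⟩ ⟨j, σ'⟩ h
    have h' : σ (a : K) + ((i : ℕ) : ℂ) * M = σ' (a : K) + ((j : ℕ) : ℂ) * M := by
      have h1 := h
      simp only [hw_def, neg_inj] at h1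
      exact h1
    by_cases hij : i = j
    · subst hij
      exact Prod.ext rfl (hinja (add_right_cancel h'))
    · exfalso
      apply hM
      rw [hbad₁_def, Finset.mem_image]
      refine ⟨((i, σ), (j, σ')), Finset.mem_univ _, ?_⟩
      have hji : ((j : ℕ) : ℂ) - ((i : ℕ) : ℂ) ≠ 0 := by
        refine sub_ne_zero.2 fun h => hij (Fin.ext ?_)
        exact_mod_cast h.symm
      show (σ (a : K) - σ' (a : K)) / (((j : ℕ) : ℂ) - ((i : ℕ) : ℂ)) = M
      rw [div_eq_iff hji]
      linear_combination h'
  -- the polynomials `pp S = ∏_{x ∈ S} (X - w x)` are pairwise distinct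
  set pp : Finset (Fin n × (K →+* ℂ)) → ℂ[X] := fun S => ∏ x ∈ S, (X - C (w x)) with hpp_def
  have hroots : ∀ S, (pp S).roots = S.val.map w := fun S => by
    rw [hpp_def]
    simp only
    rw [Finset.prod_eq_multiset_prod,
      show (fun x => X - C (w x)) = (fun z => X - C z) ∘ w from rfl, ← Multiset.map_map,
      Polynomial.roots_multiset_prod_X_sub_C]
  have hpinj : Function.Injective pp := fun S T h =>
    Finset.val_injective (Multiset.map_injective hw (by rw [← hroots, ← hroots, h]))
  -- avoid the finitely many bad common shifts
  set bad : Finset ℂ :=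
    (Finset.univ : Finset (Finset (Fin n × (K →+* ℂ)) × Finset (Fin n × (K →+* ℂ)))).biUnion
      fun st => (pp st.1 - pp st.2).roots.toFinset with hbad_def
  obtain ⟨N, hN⟩ : ∃ N : ℕ, (N : ℂ) ∉ bad := by
    by_contra h
    simp only [not_exists, not_not] at h
    exact Set.Infinite.mono (Set.range_subset_iff.2 fun N => (Finset.mem_coe.2 (h N)))
      (Set.infinite_range_of_injective (Nat.cast_injective (R := ℂ))) bad.finite_toSet
  refine ⟨fun i => a + ((i : ℕ) * M + N : ℕ), fun S T hST => ?_⟩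
  -- `∏_{(i,σ) ∈ S} σ(a + iM + N) = (pp S)(N)`
  have heval : ∀ S : Finset (Fin n × (K →+* ℂ)),
      ∏ x ∈ S, x.2 (((a + ((x.1 : ℕ) * M + N : ℕ) : 𝓞 K) : K)) = (pp S).eval (N : ℂ) := by
    intro S
    rw [hpp_def]
    simp only
    rw [Polynomial.eval_prod]
    refine Finset.prod_congr rfl fun x _ => ?_
    rw [Polynomial.eval_sub, Polynomial.eval_X, Polynomial.eval_C, hw_def]
    simp only [RingOfIntegers.coe_eq_algebraMap, map_add, map_mul, map_natCast, Nat.cast_add,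
      Nat.cast_mul, sub_neg_eq_add]
    ring
  have hST' : (pp S).eval (N : ℂ) = (pp T).eval (N : ℂ) := by
    rw [← heval, ← heval]
    exact hST
  by_contra hne
  have hp : pp S - pp T ≠ 0 := sub_ne_zero.2 fun h => hne (hpinj h)
  apply hN
  rw [hbad_def, Finset.mem_biUnion]
  refine ⟨(S, T), Finset.mem_univ _, ?_⟩
  rw [Multiset.mem_toFinset, Polynomial.mem_roots hp, Polynomial.IsRoot, Polynomial.eval_sub,
    sub_eq_zero]
  exact hST'

end GaloisP

/-! ### Discharge of the product form -/

section DischargeP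

open Literature.AlgebraicGeometry.GaoUllmo2025 (galoisClosure corestrict galAct)
open Literature.NumberTheory.Automorphic.PicardCM (eigenline)

/-- **Discharge of `Pohlmann1968_thm1_product` (Gao–Ullmo 2025, Thm. 3.1 for the CM pair
`(K^n, ⊔_i {i} × Φ_i)`; Milne 2020, 1.2 (c)) on the carriers.**  The printed proof, word for word
the one-type argument (`Pohlmann1968_thm1_holds`) on the index set `Hom(K^n, ℂ) = Fin n × Hom(K, ℂ)`:
(1) eigenbases `v_{i,σ}` of the `H¹(A_i(ℂ); ℂ)` (`exists_eigenbasis`) assemble, through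
`H¹(⨁ A_i) = ⊕_i π_i^* H¹(A_i)` (`exists_biproductBasis`), into an eigenbasis `w_{(i,σ)} = π_i^* v_{i,σ}`
of `H¹((⨁ A_i)(ℂ); ℂ)` for the `𝓞_K^n`-action `⊕_i ι_i(a_i)` (`map_biproductMap_map_π`), of Hodge type
`(1,0)` for `σ ∈ Φ_i` and `(0,1)` otherwise (pull-backs preserve types,
`IsOfHodgeType.map_of_isSmoothProjective`); (2) the cup monomials `w_S`, `|S| = 2p`, form a basis of
`H^{2p}` (`exists_monomialBasis`), `w_S` spans `H^{2p}(⨁ A)_S` (separating family `a ∈ 𝓞_K^n`,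
`exists_separating_family`); (3) `⊆` by `mem_span_monomials_of_isRationalClass` and (3.2) over
`Aut(ℂ)` = over `G` (`isGaloisBalancedFamily_iff_gal`); (4) `⊇` by `monomial_mem_span_of_stable`;
(5) the count. [cite: GaoUllmo2025, Thm. 3.1 and proof] [cite: Milne2020HodgeClassesAV, 1.2 (c)]
[cite: Pohlmann1968, Thm. 1] [cite: Gordon1999HodgeAVSurvey, §9.2] -/
theorem Pohlmann1968_thm1_product_holds : Pohlmann1968_thm1_product := by
  intro K _ _ _ n A Φ ι θ hA p
  classical
  have hX : IsSmoothProjective (⨁ A).dim (⨁ A).X := Motives.AbelianVariety.isSmoothProjective_holds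
  -- (1) a separating family, eigenbases of the factors, the eigenbasis `w` of `H¹(⨁ A)`
  obtain ⟨a, ha⟩ := exists_separating_family K n
  have ha1 : ∀ i, Function.Injective fun σ : K →+* ℂ => σ ((a i : 𝓞 K) : K) := by
    intro i σ σ' h
    have h' : ({(i, σ)} : Finset (Fin n × (K →+* ℂ))) = {(i, σ')} :=
      ha (by simpa only [Finset.prod_singleton] using h)
    exact (Prod.ext_iff.1 (Finset.singleton_injective h')).2
  have hvex : ∀ i, ∃ v : Basis (K →+* ℂ) ℂ (complexBetti (A i).X 1),
      ∀ σ (c : K), θ i c (v σ) = σ c • v σ := fun i => exists_eigenbasis (hA i) (ha1 i)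
  choose v hv using hvex
  obtain ⟨w, hw⟩ := exists_biproductBasis A v
  have hvl : ∀ i σ, v i σ ∈ eigenline (θ i) σ := fun i σ =>
    (Submodule.mem_iInf _).2 fun c => Module.End.mem_eigenspace_iff.2 (hv i σ c)
  have hθ : ∀ (i : Fin n) (c : 𝓞 K) (σ : K →+* ℂ),
      complexBetti.map (ι i c).hom.hom.hom 1 (v i σ) = σ (c : K) • v i σ := fun i c σ => by
    rw [show complexBetti.map (ι i c).hom.hom.hom 1 (v i σ) =
      (complexBetti.map (ι i c).hom.hom.hom 1).hom (v i σ) from rfl, (hA i).2.2.1 c]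
    exact hv i σ c
  have hwθ : ∀ (c : Fin n → 𝓞 K) (x : Fin n × (K →+* ℂ)),
      complexBetti.map (biproduct.map fun i => ι i (c i)).hom.hom.hom 1 (w x) =
        x.2 ((c x.1 : 𝓞 K) : K) • w x := fun c x => by
    rw [hw x, map_biproductMap_map_π, hθ, map_smul]
  have hv10 : ∀ x, (fun x : Fin n × (K →+* ℂ) => x.2 ∈ (Φ x.1).1) x →
      IsOfHodgeType (⨁ A).dim (⨁ A).X 1 1 0 (w x) := fun x hx => by
    rw [hw x]
    exact (((hA x.1).2.2.2 x.2).2.1 hx (v x.1 x.2) (hvl x.1 x.2)).map_of_isSmoothProjective hX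
      (hA x.1).1 _
  have hv01 : ∀ x, ¬ (fun x : Fin n × (K →+* ℂ) => x.2 ∈ (Φ x.1).1) x →
      IsOfHodgeType (⨁ A).dim (⨁ A).X 1 0 1 (w x) := fun x hx => by
    rw [hw x]
    exact (((hA x.1).2.2.2 x.2).2.2 hx (v x.1 x.2) (hvl x.1 x.2)).map_of_isSmoothProjective hX
      (hA x.1).1 _
  -- (2) the monomial basis of `H^{2p}(⨁ A)`
  letI : LinearOrder (Fin n × (K →+* ℂ)) :=
    LinearOrder.lift' (Fintype.equivFin (Fin n × (K →+* ℂ)))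
      (Fintype.equivFin (Fin n × (K →+* ℂ))).injective
  obtain ⟨b, hb⟩ := exists_monomialBasis w (2 * p)
  -- (3) the Galois data: `F = K^c`, eigenvalues `ev (i,σ) = σ(a_i) ∈ F`, `G = Gal(F/ℚ)` acting on
  -- `Fin n × Hom(K, ℂ)` through the second factor
  let perm : (galoisClosure K ≃ₐ[ℚ] galoisClosure K) →
      ((Fin n × (K →+* ℂ)) ↪ (Fin n × (K →+* ℂ))) := fun τ =>
    ⟨fun x => (x.1, (galAct K τ x.2.toRatAlgHom).toRingHom), fun x y h => by
      obtain ⟨h1, h2⟩ := Prod.ext_iff.1 h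
      exact Prod.ext h1 (galAct_toRingHom_injective τ h2)⟩
  let ev : Fin n × (K →+* ℂ) → galoisClosure K := fun x =>
    corestrict K x.2.toRatAlgHom ((a x.1 : 𝓞 K) : K)
  have hev : ∀ x, algebraMap (galoisClosure K) ℂ (ev x) = x.2 ((a x.1 : 𝓞 K) : K) := fun x => rfl
  have hf : ∀ x, complexBetti.map (biproduct.map fun i => ι i (a i)).hom.hom.hom 1 (w x) =
      algebraMap (galoisClosure K) ℂ (ev x) • w x := fun x => hwθ a x
  have hsep : Function.Injective fun s : Set.powersetCard (Fin n × (K →+* ℂ)) (2 * p) =>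
      ∏ i ∈ (s : Finset (Fin n × (K →+* ℂ))), ev i := by
    intro s t hst
    apply Subtype.ext
    apply ha
    have h := congrArg (algebraMap (galoisClosure K) ℂ) hst
    simpa only [map_prod, hev] using h
  have hperm : ∀ (τ : galoisClosure K ≃ₐ[ℚ] galoisClosure K) (x : Fin n × (K →+* ℂ)),
      (τ : galoisClosure K →+* galoisClosure K) (ev x) = ev (perm τ x) :=
    fun τ x => rfl
  have hfix : ∀ x : galoisClosure K, (∀ τ : galoisClosure K ≃ₐ[ℚ] galoisClosure K,
      (τ : galoisClosure K →+* galoisClosure K) x = x) →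
      x ∈ Set.range (algebraMap ℚ (galoisClosure K)) :=
    fun x hx => mem_range_algebraMap_of_forall_gal x fun τ => hx τ
  have hbal : ∀ S : Finset (Fin n × (K →+* ℂ)), IsGaloisBalancedFamily Φ S ↔
      ∀ τ : galoisClosure K ≃ₐ[ℚ] galoisClosure K,
        {x | x ∈ S ∧ (perm τ x).2 ∈ (Φ (perm τ x).1).1}.ncard =
          {x | x ∈ S ∧ (perm τ x).2 ∉ (Φ (perm τ x).1).1}.ncard :=
    fun S => isGaloisBalancedFamily_iff_gal Φ S
  -- (4) the balanced `2p`-weights, their types and their Galois stability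
  let B : Finset (Set.powersetCard (Fin n × (K →+* ℂ)) (2 * p)) :=
    Finset.univ.filter fun s => IsGaloisBalancedFamily Φ (s : Finset (Fin n × (K →+* ℂ)))
  have hBt : ∀ s ∈ B, IsOfHodgeType (⨁ A).dim (⨁ A).X (2 * p) p p (b s) := by
    intro s hs
    have hsb : IsGaloisBalancedFamily Φ (s : Finset (Fin n × (K →+* ℂ))) :=
      (Finset.mem_filter.1 hs).2
    have h := isOfHodgeType_monomial hX hb (fun x : Fin n × (K →+* ℂ) => x.2 ∈ (Φ x.1).1)
      hv10 hv01 s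
    have h1 := hsb.card_eq_two_mul
    rw [Set.powersetCard.card_eq] at h1
    have hrefl : ∀ i : K →+* ℂ, ((RingEquiv.refl ℂ : ℂ ≃+* ℂ) : ℂ →+* ℂ).comp i = i :=
      fun i => RingHom.ext fun _ => rfl
    have h0 := hsb (RingEquiv.refl ℂ)
    simp only [hrefl] at h0
    have hc : {x | x ∈ (s : Finset (Fin n × (K →+* ℂ))) ∧ x.2 ∈ (Φ x.1).1}.ncard = p := by omega
    have hc' : {x | x ∈ (s : Finset (Fin n × (K →+* ℂ))) ∧ x.2 ∉ (Φ x.1).1}.ncard = p := by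
      rw [← h0, hc]
    simp only [hc, hc'] at h
    exact h
  have hBs : ∀ τ, ∀ s ∈ B, Set.powersetCard.map (2 * p) (perm τ) s ∈ B := by
    intro τ s hs
    have hsb : IsGaloisBalancedFamily Φ (s : Finset (Fin n × (K →+* ℂ))) :=
      (Finset.mem_filter.1 hs).2
    refine Finset.mem_filter.2 ⟨Finset.mem_univ _, fun τ'' => ?_⟩
    obtain ⟨τ', hτ'⟩ := exists_ringEquiv_extends_gal τ
    have hcomp : ∀ x : Fin n × (K →+* ℂ), (τ'' : ℂ →+* ℂ).comp (perm τ x).2 =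
        ((τ'.trans τ'') : ℂ →+* ℂ).comp x.2 := fun x => by
      rw [show (perm τ x).2 = (τ' : ℂ →+* ℂ).comp x.2 from (hτ' x.2).symm,
        RingEquiv.coe_ringHom_trans, RingHom.comp_assoc]
    have hfst : ∀ x : Fin n × (K →+* ℂ), (perm τ x).1 = x.1 := fun x => rfl
    show {x | x ∈ (s : Finset (Fin n × (K →+* ℂ))).map (perm τ) ∧
        (τ'' : ℂ →+* ℂ).comp x.2 ∈ (Φ x.1).1}.ncard =
      {x | x ∈ (s : Finset (Fin n × (K →+* ℂ))).map (perm τ) ∧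
        (τ'' : ℂ →+* ℂ).comp x.2 ∉ (Φ x.1).1}.ncard
    rw [ncard_sep_map_eq', ncard_sep_map_eq']
    simp only [hcomp, hfst]
    exact hsb (τ'.trans τ'')
  -- (5) `B^p ⊗ ℂ` is the span of the balanced monomials
  have hsub : hodgeClassSpan (⨁ A).dim (⨁ A).X p ≤ Submodule.span ℂ (b '' ↑B) := by
    refine Submodule.span_le.2 ?_
    rintro c ⟨hcQ, hcH⟩
    have h := mem_span_monomials_of_isRationalClass hX hb
      (fun x : Fin n × (K →+* ℂ) => x.2 ∈ (Φ x.1).1) hv10 hv01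
      (algebraMap (galoisClosure K) ℂ) ev (biproduct.map fun i => ι i (a i)).hom.hom.hom hf hsep
      (fun τ : galoisClosure K ≃ₐ[ℚ] galoisClosure K => (τ : galoisClosure K →+* galoisClosure K))
      perm hperm (by omega : p + p = 2 * p) hcQ hcH
    refine Submodule.span_mono (Set.image_mono fun s hs => ?_) h
    rw [Finset.mem_coe, Finset.mem_filter]
    refine ⟨Finset.mem_univ _, (hbal s).2 fun τ => ?_⟩
    have h1 : {x | x ∈ (s : Finset (Fin n × (K →+* ℂ))) ∧ (perm τ x).2 ∈ (Φ (perm τ x).1).1}.ncard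
        = p := (hs τ).1
    have h2 : {x | x ∈ (s : Finset (Fin n × (K →+* ℂ))) ∧ (perm τ x).2 ∉ (Φ (perm τ x).1).1}.ncard
        = p := (hs τ).2
    rw [h1, h2]
  have hsup : Submodule.span ℂ (b '' ↑B) ≤ hodgeClassSpan (⨁ A).dim (⨁ A).X p := by
    refine Submodule.span_le.2 ?_
    rintro _ ⟨s, hs, rfl⟩
    exact monomial_mem_span_of_stable hX hb (algebraMap (galoisClosure K) ℂ) ev
      (biproduct.map fun i => ι i (a i)).hom.hom.hom hf hsep
      (fun τ : galoisClosure K ≃ₐ[ℚ] galoisClosure K => (τ : galoisClosure K →+* galoisClosure K))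
      perm hperm hfix (by omega : p + p = 2 * p) B hBt hBs hs
  have heq : hodgeClassSpan (⨁ A).dim (⨁ A).X p = Submodule.span ℂ (b '' ↑B) :=
    le_antisymm hsub hsup
  -- (6) `ℂ w_S = H^{2p}(⨁ A)_S`
  have hmono : ∀ s : Set.powersetCard (Fin n × (K →+* ℂ)) (2 * p),
      b s ∈ weightClasses A ι (2 * p) (s : Finset (Fin n × (K →+* ℂ))) := fun s =>
    mem_weightClasses_iff.2 fun c => map_monomial_eq_prod_smul hb _ (hwθ c) s
  have hline : ∀ s : Set.powersetCard (Fin n × (K →+* ℂ)) (2 * p),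
      weightClasses A ι (2 * p) (s : Finset (Fin n × (K →+* ℂ))) ≤ ℂ ∙ b s := by
    intro s x hx
    have hxu := (mem_weightClasses_iff.1 hx) a
    exact mem_span_singleton_of_apply_eq_smul' b
      (complexBetti.map (biproduct.map fun i => ι i (a i)).hom.hom.hom (2 * p)).hom
      (fun t : Set.powersetCard (Fin n × (K →+* ℂ)) (2 * p) =>
        ∏ x ∈ (t : Finset (Fin n × (K →+* ℂ))), x.2 ((a x.1 : 𝓞 K) : K))
      (fun t => map_monomial_eq_prod_smul hb _ (hwθ a) t)
      (fun t t' h => Subtype.ext (ha h)) hxu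
  have heq2 : Submodule.span ℂ (b '' ↑B) =
      ⨆ S ∈ pohlmannSetsFamily Φ p, weightClasses A ι (2 * p) S := by
    apply le_antisymm
    · refine Submodule.span_le.2 ?_
      rintro _ ⟨s, hs, rfl⟩
      have hsP : (s : Finset (Fin n × (K →+* ℂ))) ∈ pohlmannSetsFamily Φ p :=
        ⟨Set.powersetCard.card_eq s, (Finset.mem_filter.1 hs).2⟩
      exact Submodule.mem_iSup_of_mem (s : Finset (Fin n × (K →+* ℂ)))
        (Submodule.mem_iSup_of_mem hsP (hmono s))
    · refine iSup₂_le fun S hS => ?_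
      obtain ⟨hcard, hbalS⟩ := hS
      let s : Set.powersetCard (Fin n × (K →+* ℂ)) (2 * p) := Set.powersetCard.ofCard hcard
      have hsB : s ∈ B := Finset.mem_filter.2 ⟨Finset.mem_univ _, hbalS⟩
      calc weightClasses A ι (2 * p) S
          = weightClasses A ι (2 * p) (s : Finset (Fin n × (K →+* ℂ))) := rfl
        _ ≤ ℂ ∙ b s := hline s
        _ ≤ Submodule.span ℂ (b '' ↑B) :=
          Submodule.span_mono (Set.singleton_subset_iff.2 ⟨s, hsB, rfl⟩)
  refine ⟨heq.trans heq2, ?_⟩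
  -- (7) the count
  rw [heq, finrank_span_image_basis']
  have hset : pohlmannSetsFamily Φ p =
      Subtype.val '' (↑B : Set (Set.powersetCard (Fin n × (K →+* ℂ)) (2 * p))) := by
    ext S
    constructor
    · rintro ⟨hcard, hbalS⟩
      exact ⟨Set.powersetCard.ofCard hcard, Finset.mem_filter.2 ⟨Finset.mem_univ _, hbalS⟩, rfl⟩
    · rintro ⟨s, hs, rfl⟩
      exact ⟨Set.powersetCard.card_eq s, (Finset.mem_filter.1 hs).2⟩
  rw [hset, Set.ncard_image_of_injective _ Subtype.val_injective, Set.ncard_coe_finset]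

end DischargeP

end Literature.AlgebraicGeometry.Pohlmann1968

end
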